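import Summits.BirchSwinnertonDyer.BirchSwinnertonDyer.Theorems.UniversalToricDescentEisensteinCorankReadoutDual
import Literature.NumberTheory.EllipticCurves.IwasawaAlgebraSpecializationTorsionBoundProofs
import HarnessLib

/-!
# Route UniversalToricDescent — (H-ii) `hrank` of `stub_howardOutputsOfFamily` FROM HOWARD'S SHAPE `Φ_m/S_m ⊕ M ⊕ M` AND A READOUT
# of finite index and `p`-power-torsion kernel into `Sel_∞[ψ_m]` (line `beta-road` v9 on crux `TwinAlgMuZeroAtThree`, stmt-BirchSwinnertonDyer-24737)

Width prover `bsd-wall-utd-p1-w2` g11 under lead `bsd-wall-utd-p1` g23/g24 (`--supports stmt-BirchSwinnertonDyer-24737`, helper). THEOREMS ONLY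
(no definition, no named fact, no `sorry`); group theory + the two landed readout files (p749164 `…EisensteinCorankReadout`,
`…EisensteinCorankReadoutDual`); nothing arithmetic is asserted; BSD is not proved by any of this; 24737 stays OPEN.

WHAT. Howard's Thm. 1.6.1 (ii) over `S_m = Λ/(q_m)` gives `H¹_𝓕(K, A_m) ≅ 𝒜 := Φ_m/S_m × (M × M)` with `M` finite (`DVRSetting.Conclusion`);
cell x9/x10b's discrete glue reads `𝒜` into `Sel_∞ = Sel_{p^∞}(E/K_∞)` by an additive `ι : 𝒜 → Sel_∞` landing in `ker ψ_m`
(`ψ_m = (conj_γ − 1)^m + p`) with FINITE INDEX `≤ c` there (their (hSel)/(hidx)); on bucket B (`E′(K_∞)[3] = 0`) the readout is moreover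
injective — here we only ask that its kernel be killed by `p^e`. THEN, for every `k`,
`#{s ∈ ker ψ_m : p^k s = 0} ≤ c · #𝒜[p^{e+k}] ≤ (c · p^{em} · #M²) · p^{km}` (§1 group theory + p749164 `#(Φ_m/S_m)[p^j] = p^{jm}`), and the
dual readout (`…CorankReadoutDual.lambdaInvariant_quotient_qm_le_of_natCard_le`) turns this into **`lambdaInvariant p (X ⧸ q_m X) ≤ m`**, i.e. the
conjunct (H-ii) `hrank` of the v9 stub (`hrank_of_howardShape_readout`). So (H-ii) is reduced, in the kernel, to the SAME readout data as the
`μ`-side `SpecWitness` (x10b `nonempty_specWitness_of_dvrConclusion_of_readout`) plus the `p`-power bound on its kernel.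

* §1 `natCard_torsion_le_index_mul` (`#A[n] ≤ [A:B]·#B[n]`), `natCard_torsion_le_of_surjective` (`#B[n] ≤ #A[n₀ n]` along a surjection with
  `n₀`-torsion kernel), `natCard_torsion_prod`, `natCard_torsion_le_natCard`.
* §2 `natCard_nsmul_torsion_fracModR_eisensteinQuotient` (`#(Φ_m/S_m)[p^j] = p^{jm}`, `ℕ`-torsion form), `finite_and_natCard_torsion_howardShape_le`
  (`#𝒜[p^j] ≤ p^{jm}·#M²`), **`natCard_ker_torsion_le_of_readout`** (the displayed count).
* §3 **`lambdaInvariant_quotient_qm_le_of_howardShape_readout`** (one `m`) and **`hrank_of_howardShape_readout`** (the stub's binder `∀ m₀ ∃ m ≥ m₀,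
  λ(X/q_m X) ≤ m + C′`, from readouts at all large `m`).

References: [Howard2004HeegnerKolyvagin] Thm. 1.6.1 (ii), Lemma 2.2.7, Prop. 2.2.8, proof of Thm. 2.2.10; [GreenbergLNM1716] §4 p. 98;
[MastellaZerman2026] Thm. 2.40 (shape `Φ/R ⊕ M ⊕ M`).
-/

set_option linter.dupNamespace false
set_option autoImplicit false

noncomputable section

open scoped Classical

namespace Summit.BirchSwinnertonDyer.BirchSwinnertonDyer.Theorems.UniversalToricDescentEisensteinHowardRankReadout

open Literature.NumberTheory.EllipticCurves Literature.NumberTheory.EllipticCurves.IwasawaAlgebra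
  Literature.NumberTheory.GaloisCohomology.Howard2004
  Summit.BirchSwinnertonDyer.BirchSwinnertonDyer.Theorems.UniversalToricDescentEisensteinCorankReadout
  Summit.BirchSwinnertonDyer.BirchSwinnertonDyer.Theorems.UniversalToricDescentEisensteinCorankReadoutDual

universe u v w

/-! ## §1 Torsion counts: finite index, finite-exponent kernels, products -/

/-- **`#A[n] ≤ [A : B] · #B[n]`** for a subgroup `B` of finite index (`A[n] = {a : n • a = 0}`), when `B[n]` is finite: `A[n]/(A[n] ∩ B) ↪ A/B` and
`A[n] ∩ B ⊆ B[n]`. [folklore] -/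
theorem natCard_torsion_le_index_mul {A : Type u} [AddCommGroup A] (B : AddSubgroup A) [B.FiniteIndex] (n : ℕ)
    [Finite {b : B // n • b = 0}] :
    Finite {a : A // n • a = 0} ∧ Nat.card {a : A // n • a = 0} ≤ B.index * Nat.card {b : B // n • b = 0} := by
  let T : AddSubgroup A := (DistribSMul.toAddMonoidHom A n).ker
  have hT : ∀ a : A, a ∈ T ↔ n • a = 0 := fun a ↦ by rw [AddMonoidHom.mem_ker]; rfl
  let eT : T ≃ {a : A // n • a = 0} := Equiv.subtypeEquivRight hT
  let f : T →+ A ⧸ B := (QuotientAddGroup.mk' B).comp T.subtype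
  have hker : ∀ t : T, t ∈ f.ker ↔ (t : A) ∈ B := fun t ↦ by
    rw [AddMonoidHom.mem_ker, AddMonoidHom.comp_apply, AddSubgroup.subtype_apply, QuotientAddGroup.mk'_apply,
      QuotientAddGroup.eq_zero_iff]
  let g : f.ker → {b : B // n • b = 0} := fun t ↦ ⟨⟨(t : T), (hker t).mp t.2⟩, Subtype.ext (by
    rw [AddSubgroup.coe_nsmul, AddSubgroup.coe_zero]; exact (hT _).mp (t : T).2)⟩
  have hg : Function.Injective g := by
    rintro ⟨⟨a, ha⟩, ha'⟩ ⟨⟨b, hb⟩, hb'⟩ h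
    have := congrArg (fun x : {b : B // n • b = 0} ↦ ((x : B) : A)) h
    exact Subtype.ext (Subtype.ext this)
  haveI : Finite f.ker := Finite.of_injective g hg
  haveI : Finite f.range := inferInstance
  have hcard : Nat.card T = Nat.card f.ker * Nat.card f.range := by
    rw [← Nat.card_congr (QuotientAddGroup.quotientKerEquivRange f).toEquiv, mul_comm,
      ← AddSubgroup.card_eq_card_quotient_mul_card_addSubgroup]
  haveI : Finite T :=
    Nat.finite_of_card_ne_zero (by rw [hcard]; exact Nat.mul_ne_zero Nat.card_pos.ne' Nat.card_pos.ne')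
  refine ⟨Finite.of_equiv _ eT, ?_⟩
  calc Nat.card {a : A // n • a = 0} = Nat.card T := Nat.card_congr eT.symm
    _ = Nat.card f.ker * Nat.card f.range := hcard
    _ ≤ Nat.card {b : B // n • b = 0} * Nat.card (A ⧸ B) :=
        Nat.mul_le_mul (Nat.card_le_card_of_injective g hg) (Nat.card_le_card_of_injective _ f.range.subtype_injective)
    _ = B.index * Nat.card {b : B // n • b = 0} := by rw [AddSubgroup.index, mul_comm]

/-- **`#B[n] ≤ #A[n₀ n]`** for a surjection `π : A → B` whose kernel is killed by `n₀` (when `A[n₀ n]` is finite): `{a : n • π a = 0} ⊆ A[n₀ n]`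
surjects onto `B[n]`. [folklore] -/
theorem natCard_torsion_le_of_surjective {A : Type u} {B : Type v} [AddCommGroup A] [AddCommGroup B] (π : A →+ B)
    (hπ : Function.Surjective π) (n₀ : ℕ) (hK : ∀ a : A, π a = 0 → n₀ • a = 0) (n : ℕ) [Finite {a : A // (n₀ * n) • a = 0}] :
    Finite {b : B // n • b = 0} ∧ Nat.card {b : B // n • b = 0} ≤ Nat.card {a : A // (n₀ * n) • a = 0} := by
  let S := {a : A // n • π a = 0}
  let i : S → {a : A // (n₀ * n) • a = 0} := fun a ↦ ⟨a, by
    rw [mul_nsmul']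
    exact hK _ (by rw [map_nsmul]; exact a.2)⟩
  have hi : Function.Injective i := fun a b h ↦ Subtype.ext (congrArg (fun x : {a : A // (n₀ * n) • a = 0} ↦ (x : A)) h)
  haveI : Finite S := Finite.of_injective i hi
  let s : S → {b : B // n • b = 0} := fun a ↦ ⟨π a, a.2⟩
  have hs : Function.Surjective s := by
    rintro ⟨b, hb⟩
    obtain ⟨a, rfl⟩ := hπ b
    exact ⟨⟨a, hb⟩, rfl⟩
  exact ⟨Finite.of_surjective s hs, (Nat.card_le_card_of_surjective s hs).trans (Nat.card_le_card_of_injective i hi)⟩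

/-- `#(A × B)[n] = #A[n] · #B[n]` (`(A × B)[n] ≃ A[n] × B[n]`). [folklore] -/
theorem natCard_torsion_prod {A : Type u} {B : Type v} [AddCommGroup A] [AddCommGroup B] (n : ℕ) :
    Nat.card {x : A × B // n • x = 0} = Nat.card {a : A // n • a = 0} * Nat.card {b : B // n • b = 0} := by
  rw [← Nat.card_prod]
  exact Nat.card_congr ⟨fun x ↦ (⟨x.1.1, (Prod.ext_iff.mp x.2).1⟩, ⟨x.1.2, (Prod.ext_iff.mp x.2).2⟩),
    fun y ↦ ⟨(y.1.1, y.2.1), Prod.ext y.1.2 y.2.2⟩, fun _ ↦ rfl, fun _ ↦ rfl⟩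

/-- `#M[n] ≤ #M` for a finite group. [folklore] -/
theorem natCard_torsion_le_natCard {M : Type u} [AddCommGroup M] [Finite M] (n : ℕ) :
    Nat.card {x : M // n • x = 0} ≤ Nat.card M :=
  Nat.card_le_card_of_injective _ Subtype.val_injective

/-! ## §2 Howard's shape `𝒜 = Φ_m/S_m × (M × M)`: `#𝒜[p^j] ≤ p^{jm} · #M²`, and the readout count -/

section Shape

variable (p : ℕ) [hp : Fact p.Prime]

-- `S_m = Λ/(q_m)` is a domain for `m ≥ 1`: tree `IwasawaAlgebra.isDomain_quotient_X_pow_add_C`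
-- (`Literature/NumberTheory/EllipticCurves/IwasawaAlgebraEisensteinQuotientDVRProofs.lean`); below it is an instance argument.

/-- **`#(Φ_m/S_m)[p^j] = p^{jm}`** (`ℕ`-torsion form of p749164's `natCard_pow_torsion_fracModR_eisensteinQuotient`).
[cite: Howard2004HeegnerKolyvagin, Thm. 1.6.1 (𝒟 = Φ/R)] -/
theorem natCard_nsmul_torsion_fracModR_eisensteinQuotient {m : ℕ} (hm : 1 ≤ m)
    [IsDomain (IwasawaAlgebra p ⧸ Ideal.span {(PowerSeries.X ^ m + PowerSeries.C (p : ℤ_[p]) : IwasawaAlgebra p)})] (j : ℕ) :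
    Nat.card {d : FracModR (IwasawaAlgebra p ⧸
        Ideal.span {(PowerSeries.X ^ m + PowerSeries.C (p : ℤ_[p]) : IwasawaAlgebra p)}) // p ^ j • d = 0} = p ^ (j * m) := by
  rw [← natCard_pow_torsion_fracModR_eisensteinQuotient p hm j]
  refine Nat.card_congr (Equiv.subtypeEquivRight fun d ↦ ?_)
  rw [← Nat.cast_pow, Nat.cast_smul_eq_nsmul]

/-- **`#𝒜[p^j] ≤ p^{jm} · #M · #M`** for `𝒜 = Φ_m/S_m × (M × M)`, `M` finite (and `𝒜[p^j]` is finite). [cite: Howard2004HeegnerKolyvagin, Thm. 1.6.1] -/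
theorem finite_and_natCard_torsion_howardShape_le {m : ℕ} (hm : 1 ≤ m)
    [IsDomain (IwasawaAlgebra p ⧸ Ideal.span {(PowerSeries.X ^ m + PowerSeries.C (p : ℤ_[p]) : IwasawaAlgebra p)})]
    (M : Type w) [AddCommGroup M] [Finite M] (j : ℕ) :
    Finite {a : FracModR (IwasawaAlgebra p ⧸
        Ideal.span {(PowerSeries.X ^ m + PowerSeries.C (p : ℤ_[p]) : IwasawaAlgebra p)}) × (M × M) // p ^ j • a = 0} ∧
      Nat.card {a : FracModR (IwasawaAlgebra p ⧸
        Ideal.span {(PowerSeries.X ^ m + PowerSeries.C (p : ℤ_[p]) : IwasawaAlgebra p)}) × (M × M) // p ^ j • a = 0} ≤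
        p ^ (j * m) * (Nat.card M * Nat.card M) := by
  have hD := natCard_nsmul_torsion_fracModR_eisensteinQuotient p hm j
  haveI : Finite {x : M // p ^ j • x = 0} := Finite.of_injective _ Subtype.val_injective
  have hcard : Nat.card {a : FracModR (IwasawaAlgebra p ⧸
        Ideal.span {(PowerSeries.X ^ m + PowerSeries.C (p : ℤ_[p]) : IwasawaAlgebra p)}) × (M × M) // p ^ j • a = 0} =
      p ^ (j * m) * (Nat.card {x : M // p ^ j • x = 0} * Nat.card {x : M // p ^ j • x = 0}) := by
    rw [natCard_torsion_prod, hD, natCard_torsion_prod]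
  have hMpos : 0 < Nat.card {x : M // p ^ j • x = 0} := by
    haveI : Nonempty {x : M // p ^ j • x = 0} := ⟨⟨0, smul_zero _⟩⟩
    exact Nat.card_pos
  refine ⟨Nat.finite_of_card_ne_zero (by
      rw [hcard]; exact Nat.mul_ne_zero (pow_ne_zero _ hp.out.ne_zero) (Nat.mul_ne_zero hMpos.ne' hMpos.ne')), ?_⟩
  rw [hcard]
  exact Nat.mul_le_mul_left _ (Nat.mul_le_mul (natCard_torsion_le_natCard _) (natCard_torsion_le_natCard _))

/-- **The readout count.** `S` an abelian group with an endomorphism `ψ`; Howard's shape `𝒜 = Φ_m/S_m × (M × M)` (`M` finite) read into `S` by an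
additive `ι` landing in `ker ψ`, of finite index `≤ c` there, with kernel killed by `p^e`. Then for every `k`:
`#{s ∈ ker ψ : p^k s = 0} ≤ (c · (p^{em} · #M²)) · p^{km}` (and the set is finite).
[cite: Howard2004HeegnerKolyvagin, Thm. 1.6.1 (ii), Prop. 2.2.8] [cite: GreenbergLNM1716, §4 p. 98] -/
theorem natCard_ker_torsion_le_of_readout {m : ℕ} (hm : 1 ≤ m)
    [IsDomain (IwasawaAlgebra p ⧸ Ideal.span {(PowerSeries.X ^ m + PowerSeries.C (p : ℤ_[p]) : IwasawaAlgebra p)})]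
    {M : Type w} [AddCommGroup M] [Finite M] {S : Type v} [AddCommGroup S] (ψ : S →+ S)
    (ι : FracModR (IwasawaAlgebra p ⧸
        Ideal.span {(PowerSeries.X ^ m + PowerSeries.C (p : ℤ_[p]) : IwasawaAlgebra p)}) × (M × M) →+ S)
    (hι : ∀ a, ψ (ι a) = 0) (c : ℕ) (hfin : Finite (ψ.ker ⧸ (ι.range).addSubgroupOf ψ.ker))
    (hidx : Nat.card (ψ.ker ⧸ (ι.range).addSubgroupOf ψ.ker) ≤ c) (e : ℕ) (hK : ∀ a, ι a = 0 → p ^ e • a = 0) (k : ℕ) :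
    Finite {s : ψ.ker // p ^ k • s = 0} ∧
      Nat.card {s : ψ.ker // p ^ k • s = 0} ≤ (c * (p ^ (e * m) * (Nat.card M * Nat.card M))) * p ^ (k * m) := by
  set B : AddSubgroup ψ.ker := (ι.range).addSubgroupOf ψ.ker with hB
  haveI : B.FiniteIndex := AddSubgroup.finiteIndex_of_finite_quotient
  -- `𝒜 ↠ B` with kernel killed by `p^e`
  let π : FracModR (IwasawaAlgebra p ⧸
      Ideal.span {(PowerSeries.X ^ m + PowerSeries.C (p : ℤ_[p]) : IwasawaAlgebra p)}) × (M × M) →+ B :=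
    { toFun := fun a ↦ ⟨⟨ι a, (AddMonoidHom.mem_ker).mpr (hι a)⟩, AddSubgroup.mem_addSubgroupOf.mpr ⟨a, rfl⟩⟩
      map_zero' := Subtype.ext (Subtype.ext (by simp))
      map_add' := fun a b ↦ Subtype.ext (Subtype.ext (by simp)) }
  have hπ_coe : ∀ a, (((π a : B) : ψ.ker) : S) = ι a := fun _ ↦ rfl
  have hπ : Function.Surjective π := by
    rintro ⟨⟨s, hs⟩, hsB⟩
    obtain ⟨a, ha⟩ := AddSubgroup.mem_addSubgroupOf.mp hsB
    exact ⟨a, Subtype.ext (Subtype.ext ha)⟩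
  have hπK : ∀ a, π a = 0 → p ^ e • a = 0 := fun a ha ↦
    hK a (by rw [← hπ_coe, ha]; rfl)
  -- counts
  obtain ⟨hAfin, hAle⟩ := finite_and_natCard_torsion_howardShape_le p hm M (e + k)
  have hpow : p ^ e * p ^ k = p ^ (e + k) := (pow_add p e k).symm
  haveI : Finite {a : FracModR (IwasawaAlgebra p ⧸
      Ideal.span {(PowerSeries.X ^ m + PowerSeries.C (p : ℤ_[p]) : IwasawaAlgebra p)}) × (M × M) // (p ^ e * p ^ k) • a = 0} := by
    rw [hpow]; exact hAfin
  obtain ⟨hBfin, hBle⟩ := natCard_torsion_le_of_surjective π hπ (p ^ e) hπK (p ^ k)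
  haveI := hBfin
  obtain ⟨hSfin, hSle⟩ := natCard_torsion_le_index_mul B (p ^ k)
  refine ⟨hSfin, hSle.trans ?_⟩
  have hindex : B.index ≤ c := hidx
  rw [hpow] at hBle
  calc B.index * Nat.card {b : B // p ^ k • b = 0}
      ≤ c * (p ^ ((e + k) * m) * (Nat.card M * Nat.card M)) := Nat.mul_le_mul hindex (hBle.trans hAle)
    _ = (c * (p ^ (e * m) * (Nat.card M * Nat.card M))) * p ^ (k * m) := by rw [Nat.add_mul, pow_add]; ring

end Shape

/-! ## §3 (H-ii) `hrank` from Howard's shape and the readout -/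

section Selmer

open WeierstrassCurve

variable {p : ℕ} [hp : Fact p.Prime]
variable {K : Type u} [Field K] [NumberField K] {W : WeierstrassCurve K} {κ : ZpExtension K p}
  {γ : Field.absoluteGaloisGroup K}

/-- **`λ(X/q_m X) ≤ m` from Howard's shape and the readout at ONE `m ≥ 1`.** `D` any dual datum of `Sel_∞ = Sel_{p^∞}(E/K_∞)` with `X = D.X`
finitely generated; `ψ_m = (conj_γ − 1)^m + p`; `𝒜 = Φ_m/S_m × (M × M)` (`M` finite) with `ι : 𝒜 →+ Sel_∞` landing in `ker ψ_m`, of finite index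
`≤ c` there, kernel killed by `p^e`. Then `lambdaInvariant p (X ⧸ q_m X) ≤ m`. [cite: Howard2004HeegnerKolyvagin, Thm. 1.6.1 (ii), proof of Thm. 2.2.10]
[cite: GreenbergLNM1716, §4 p. 98] -/
theorem lambdaInvariant_quotient_qm_le_of_howardShape_readout (D : W.SelmerDualData κ γ)
    [Module.Finite (IwasawaAlgebra p) D.X] {m : ℕ} (hm : 1 ≤ m)
    [IsDomain (IwasawaAlgebra p ⧸ Ideal.span {(PowerSeries.X ^ m + PowerSeries.C (p : ℤ_[p]) : IwasawaAlgebra p)})]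
    {M : Type} [AddCommGroup M] [Finite M]
    (ι : FracModR (IwasawaAlgebra p ⧸
        Ideal.span {(PowerSeries.X ^ m + PowerSeries.C (p : ℤ_[p]) : IwasawaAlgebra p)}) × (M × M) →+ W.selmerInfty κ)
    (hι : ∀ a, ((W.conjSelmerInfty κ γ - 1) ^ m + (p : AddMonoid.End (W.selmerInfty κ))) (ι a) = 0)
    (c : ℕ)
    (hfin : Finite (((W.conjSelmerInfty κ γ - 1) ^ m + (p : AddMonoid.End (W.selmerInfty κ))).ker ⧸ (ι.range).addSubgroupOf _))
    (hidx : Nat.card (((W.conjSelmerInfty κ γ - 1) ^ m + (p : AddMonoid.End (W.selmerInfty κ))).ker ⧸ (ι.range).addSubgroupOf _) ≤ c)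
    (e : ℕ) (hK : ∀ a, ι a = 0 → p ^ e • a = 0) :
    lambdaInvariant p (D.X ⧸ ((Ideal.span {(PowerSeries.X ^ m + PowerSeries.C (p : ℤ_[p]) : IwasawaAlgebra p)} :
      Ideal (IwasawaAlgebra p)) • (⊤ : Submodule (IwasawaAlgebra p) D.X))) ≤ m := by
  refine lambdaInvariant_quotient_qm_le_of_natCard_le D hm m (c * (p ^ (e * m) * (Nat.card M * Nat.card M))) fun k ↦ ?_
  exact natCard_ker_torsion_le_of_readout p hm _ ι hι c hfin hidx e hK k

end Selmer

/-! ## §4 (appended) The stub's binder `∀ m₀ ∃ m ≥ m₀, λ(X/q_m X) ≤ m + C′` from readouts at all large `m` -/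

section HRank

open WeierstrassCurve

variable {p : ℕ} [hp : Fact p.Prime]
variable {K : Type u} [Field K] [NumberField K] {W : WeierstrassCurve K} {κ : ZpExtension K p}
  {γ : Field.absoluteGaloisGroup K}

/-- **Conjunct (H-ii) `hrank` of `stub_howardOutputsOfFamily`, VERBATIM, from Howard's shape + readout at every large `m`.** `D` any dual datum of
`Sel_∞` with `X = D.X` finitely generated; for every `m ≥ m₁` (with `S_m = Λ/(q_m)` a domain — tree `IwasawaAlgebra.isDomain_quotient_X_pow_add_C`,
supplied inside) a finite `M`, a readout `ι : Φ_m/S_m × (M × M) →+ Sel_∞` landing in `ker ψ_m` with finite index and `p^e`-torsion kernel. Then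
`∀ m₀, ∃ m ≥ m₀, lambdaInvariant p (X ⧸ q_m X) ≤ m + C′` (any `C′`; in fact `≤ m`). [cite: Howard2004HeegnerKolyvagin, Thm. 1.6.1 (ii), proof of Thm. 2.2.10] -/
theorem hrank_of_howardShape_readouts (D : W.SelmerDualData κ γ) [Module.Finite (IwasawaAlgebra p) D.X] (C' m₁ : ℕ)
    (hread : ∀ m : ℕ, m₁ ≤ m → 1 ≤ m →
      ∀ [IsDomain (IwasawaAlgebra p ⧸ Ideal.span {(PowerSeries.X ^ m + PowerSeries.C (p : ℤ_[p]) : IwasawaAlgebra p)})],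
      ∃ (M : Type) (_ : AddCommGroup M) (_ : Finite M)
        (ι : FracModR (IwasawaAlgebra p ⧸
            Ideal.span {(PowerSeries.X ^ m + PowerSeries.C (p : ℤ_[p]) : IwasawaAlgebra p)}) × (M × M) →+ W.selmerInfty κ)
        (c e : ℕ),
        (∀ a, ((W.conjSelmerInfty κ γ - 1) ^ m + (p : AddMonoid.End (W.selmerInfty κ))) (ι a) = 0) ∧
        Finite (((W.conjSelmerInfty κ γ - 1) ^ m + (p : AddMonoid.End (W.selmerInfty κ))).ker ⧸ (ι.range).addSubgroupOf _) ∧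
        Nat.card (((W.conjSelmerInfty κ γ - 1) ^ m + (p : AddMonoid.End (W.selmerInfty κ))).ker ⧸ (ι.range).addSubgroupOf _) ≤ c ∧
        (∀ a, ι a = 0 → p ^ e • a = 0)) :
    ∀ m₀ : ℕ, ∃ m : ℕ, m₀ ≤ m ∧
      lambdaInvariant p (D.X ⧸ ((Ideal.span {(PowerSeries.X ^ m + PowerSeries.C (p : ℤ_[p]) : IwasawaAlgebra p)} :
        Ideal (IwasawaAlgebra p)) • (⊤ : Submodule (IwasawaAlgebra p) D.X))) ≤ m + C' := by
  intro m₀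
  set m := max m₀ (max m₁ 1) with hmdef
  have hm₀ : m₀ ≤ m := le_max_left _ _
  have hm₁ : m₁ ≤ m := le_trans (le_max_left _ _) (le_max_right _ _)
  have hm : 1 ≤ m := le_trans (le_max_right _ _) (le_max_right _ _)
  haveI := isDomain_quotient_X_pow_add_C p hm
  obtain ⟨M, _, _, ι, c, e, hι, hfin, hidx, hK⟩ := hread m hm₁ hm
  exact ⟨m, hm₀, (lambdaInvariant_quotient_qm_le_of_howardShape_readout D hm ι hι c hfin hidx e hK).trans (Nat.le_add_right _ _)⟩

end HRank

end Summit.BirchSwinnertonDyer.BirchSwinnertonDyer.Theorems.UniversalToricDescentEisensteinHowardRankReadout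

end
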